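import Summits.PneNP.PneNP.Theorems.SoloInformedResBoundNP
import Literature.Computability.Complexity.SearchToDecision
import Literature.Computability.Complexity.CNFRelabel
import Literature.Computability.MetaComplexity.Xorification
import Literature.Computability.Complexity.SumcheckIPReferee
import HarnessLib

/-!
# The search face of the summit: `PneNP ↔` no `g ∈ FP` pad-automates Resolution

Soloist file (`solo-PneNP-informed`; prefix `SoloInformed`). `soloInformed_pneNP_iff_resBound`
types the DECISION form of Resolution proof search (`RESBOUND ∈ P`?); this file types the SEARCH
form the literature calls automatability [Atserias–Müller 2020, §1: given `F`, output a refutation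
in time polynomial in `|F| + s`, `s` the shortest refutation length], in the padded variant natural
for string functions (`resPadSearchFns`: on `⟨code F, 1^s⟩`, if `F` has a refutation with `≤ s`
lines, output a code of SOME refutation of `F`; the two variants are interchangeable by padding /
doubling `s` against the polynomial-time checker `SoloResNP.refB`, not formalised here).

* `soloInformed_exists_resPadSearchFn_of_NP_subset_P` — `NP ⊆ P →` such a `g ∈ FP` exists:
  search-to-decision [AroraBarakCC2009, Thm 2.18] (`exists_searchFn_of_NP_subset_P`) on the
  verifier `SoloResNP.resVerLang ∈ P` of `RESBOUND`.
* `soloInformed_NP_subset_P_of_resPadSearchFn` — **[AtseriasMuller2020, Thm 1] proper**: a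
  pad-automating `g ∈ FP` with output length `≤ q(·)` decides `3SAT` — rename variables densely
  (`SoloResAut.rankCNF`), pad by `n₁ = n₁(q)` (the new point over the decision form: the threshold
  depends on the running time of `g`), apply the gadget `G`, run `g` with budget `r^C`, accept iff
  the output is a refutation (`SoloResAut.exists_gap_threshold`, from the `2^{r^{1/d}}` lower bound
  `rrefGadget_hardness_holds` [AM20, Thm 2 (b)]).
* `soloInformed_pneNP_iff_forall_not_mem_resPadSearchFns : PneNP ↔ ∀ g ∈ FP, g ∉ resPadSearchFns`,
  `soloInformed_resBound_mem_P_iff_exists_resPadSearchFn` (search ≡ decision).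

A kernel-checked sharpening of the summit STATEMENT, not progress toward it. Refs: A. Atserias,
M. Müller, *Automating Resolution is NP-hard*, J. ACM 67(5) (2020) Art. 31, §1, Thm 1–2;
S. Arora, B. Barak, *Computational Complexity* (2009), Thm 2.18; [CookReckhow1979, Def. 1.4].
-/

namespace Summit.PneNP.PneNP.Theorems

open Literature.Computability.Complexity Literature.Computability.MetaComplexity
open _root_.Computability Literature.Computability.Complexity.CodeFP
open Literature.Computability.Complexity.Brick (fstF_boolPair sndF_boolPair)
open Literature.Computability.Complexity.Expander.E3LC (cnfE cnfE_eq litE rawClausesFP ulengthFP)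
open SoloRes (normCNF)

/-- **Pad-automating functions for Resolution** (search form of automatability, budget in unary):
the string functions `g` such that for every CNF `F` and every `s`, if `F` has a Resolution
refutation with at most `s` lines then the clause list decoded (totally, by `NegCNF.decCNF` and
`SoloResNP.lineOf`) from `g ⟨code F, 1^s⟩ ` is a Resolution refutation of `F`. Resolution is
pad-automatable iff `FP` meets this set. [cite: AtseriasMuller2020, §1 (automatability)] -/
def resPadSearchFns : Set (List Bool → List Bool) :=
  {g | ∀ (F : CNF ℕ) (s : ℕ), (∃ π : List (ResLine ℕ), IsResRefutation F π ∧ π.length ≤ s) →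
    IsResRefutation F
      ((NegCNF.decCNF (g (boolPair (encodingCNF.encode F) (unE s)))).map SoloResNP.lineOf)}

/-- **`NP ⊆ P →` Resolution is pad-automatable**: search reduces to decision
[Arora–Barak 2009, Thm 2.18] for the polynomial verifier `SoloResNP.resVerLang` of `RESBOUND`.
[cite: AroraBarakCC2009, Thm. 2.18] [cite: AtseriasMuller2020, Thm 1] -/
theorem soloInformed_exists_resPadSearchFn_of_NP_subset_P
    (hNP : Nondeterministic.NP ⊆ Classes.P) : ∃ g ∈ FP, g ∈ resPadSearchFns := by
  obtain ⟨g, hg, hspec⟩ := exists_searchFn_of_NP_subset_P hNP SoloResNP.resVerLang_mem_P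
    (2 * Polynomial.X + 2 + Polynomial.X * (2 * (2 * (2 * Polynomial.X + 4) + 2 +
      (2 * Polynomial.X + 4) * (2 * (2 * Polynomial.X + 3) + 2)) + 2))
  refine ⟨g, hg, ?_⟩; rw [resPadSearchFns, Set.mem_setOf_eq]
  intro F s hπ
  have hx : boolPair (encodingCNF.encode F) (unE s) ∈ resBoundLang :=
    (boolPair_mem_resBoundLang_iff F _).2 (by rwa [length_unE])
  have hv : SoloResNP.verB (boolPair (boolPair (encodingCNF.encode F) (unE s))
      (g (boolPair (encodingCNF.encode F) (unE s)))) = true :=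
    (hspec _ ((SoloResNP.isPolyVerifierFor_resBound _).1 hx)).2
  unfold SoloResNP.verB at hv
  rw [Bool.and_eq_true, Bool.and_eq_true] at hv
  have href := hv.2.2
  simp only [fstF_boolPair, sndF_boolPair, length_unE, KSATRed.decCNF_encode] at href
  exact ((SoloResNP.refB_eq_true_iff _ _ _).1 href).1

namespace SoloResAut

/-- **Dense renaming**: each variable is replaced by its rank among the occurring ones.
[folklore] -/
def rankCNF (F : CNF ℕ) : CNF ℕ :=
  F.map fun c => c.map fun l => ((RefCNF.sortedVars F).idxOf l.1, l.2)

/-- Dense renaming preserves satisfiability (injective on the occurring variables). [folklore] -/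
theorem satisfiable_rankCNF_iff (F : CNF ℕ) : (rankCNF F).Satisfiable ↔ F.Satisfiable := by
  refine CNF.satisfiable_relabel_iff_of_injOn (f := fun v => (RefCNF.sortedVars F).idxOf v)
    (φ := F) fun v hv w _ h => ?_
  rw [CNF.mem_varSet_iff_mem_vars] at hv
  exact (List.idxOf_inj ((Finset.mem_sort _).2 hv)).1 h

/-- Dense renaming preserves clause widths. [folklore] -/
theorem isWidthLE_rankCNF {F : CNF ℕ} {k : ℕ} (h : F.IsWidthLE k) : (rankCNF F).IsWidthLE k := by
  intro c hc
  obtain ⟨c₀, hc₀, rfl⟩ := List.mem_map.1 hc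
  rw [List.length_map]; exact h c₀ hc₀

/-- **Density**: the variables of `rankCNF F`, `F` a 3-CNF, are below `3·|F|`. [folklore] -/
theorem lt_of_mem_rankCNF {F : CNF ℕ} (hw : F.IsWidthLE 3) {c : Clause ℕ} (hc : c ∈ rankCNF F)
    {l : Literal ℕ} (hl : l ∈ c) : l.1 < 3 * (rankCNF F).length := by
  obtain ⟨c₀, hc₀, rfl⟩ := List.mem_map.1 hc
  obtain ⟨l₀, hl₀, rfl⟩ := List.mem_map.1 hl
  have h1 : (RefCNF.sortedVars F).idxOf l₀.1 < F.vars.card := by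
    rw [← Finset.length_sort (· ≤ ·)]
    exact List.idxOf_lt_length_iff.2 ((Finset.mem_sort _).2 (SoloResNP.mem_vars_of_mem hc₀ hl₀))
  have h2 : F.vars.card ≤ F.flatten.length :=
    (List.toFinset_card_le _).trans (by rw [List.length_map])
  have h3 : F.flatten.length ≤ 3 * F.length := by
    rw [List.length_flatten, Nat.mul_comm, ← smul_eq_mul, ← List.length_map (f := List.length)]
    exact List.sum_le_card_nsmul _ _ fun x hx => by
      obtain ⟨c, hc, rfl⟩ := List.mem_map.1 hx; exact hw c hc
  rw [show (rankCNF F).length = F.length from List.length_map ..]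
  exact h1.trans_le (h2.trans h3)

/-- **Dense renaming is polynomial-time** (index in the sorted variable list).
[cite: AroraBarakCC2009, §1.3] -/
theorem rankFP : CodeFP cnfE cnfE rankCNF := by
  have hlit : CodeFP (pairE (rawE natE) litE) litE (fun p => (p.1.idxOf p.2.1, p.2.2)) :=
    (idxOfNat.comp ((snd _ _).fst'.pair (fst _ _))).pair (snd _ _).snd'
  have hcl : CodeFP (pairE (rawE natE) (rawE litE)) (rawE litE)
      (fun p => p.2.map fun l => (p.1.idxOf l.1, l.2)) := CodeFP.map hlit
  have hF : CodeFP (pairE (rawE natE) (rawE (rawE litE))) (rawE (rawE litE))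
      (fun p => p.2.map fun c => c.map fun l => (p.1.idxOf l.1, l.2)) := CodeFP.map hcl
  exact (SoloRes.toCnfFP.comp (hF.comp ((RefCNF.sortedVarsFP.comp rawClausesFP).pair
    rawClausesFP))).congr fun F => rfl

/-- Code length of a CNF of width `≤ w` over variables `≤ V`. [folklore] -/
theorem length_cnfE_le {F : CNF ℕ} {w V : ℕ} (hw : F.IsWidthLE w)
    (hV : ∀ c ∈ F, ∀ l ∈ c, l.1 ≤ V) :
    (cnfE F).length ≤ 2 * F.length + 2 +
      F.length * (2 * (2 * w + 2 + w * (2 * (2 * V + 3) + 2)) + 2) := by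
  have hlit : ∀ c ∈ F, ∀ l ∈ c, (litE l).length ≤ 2 * V + 3 := fun c hc l hl => by
    rw [show litE l = boolPair (natE l.1) (bitE l.2) from rfl, length_boolPair]
    have := (length_natE_le l.1).trans (hV c hc l hl)
    show 2 * (natE l.1).length + 2 + 1 ≤ _
    omega
  have hcl : ∀ c ∈ F, (listE litE c).length ≤ 2 * w + 2 + w * (2 * (2 * V + 3) + 2) := by
    intro c hc
    rw [listE, length_boolPair, length_unE]
    have h1 := LMat.length_rawE_le_mul litE (hlit c hc)
    have h2 := hw c hc
    exact Nat.add_le_add (by omega) (h1.trans (Nat.mul_le_mul_right _ h2))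
  have h5 : (cnfE F).length = 2 * F.length + 2 + (rawE (listE litE) F).length := by
    rw [cnfE, listE, length_boolPair, length_unE]
  rw [h5]
  exact Nat.add_le_add_left (LMat.length_rawE_le_mul (listE litE) hcl) _

/-- The normalization has `2|F| + n₀` clauses. [folklore] -/
private theorem length_normCNF (n₀ : ℕ) (F : CNF ℕ) :
    (normCNF n₀ F).length = 2 * F.length + n₀ := by
  simp [SoloRes.normCNF, SoloRes.freshUnits]; ring

/-- Variables of `N(F)` for a dense `F` (literals `< n`) are at most `n + |F| + n₀`. [folklore] -/
theorem le_of_mem_normCNF {F : CNF ℕ} {n n₀ : ℕ} (hF : ∀ c ∈ F, ∀ l ∈ c, l.1 < n)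
    {c : Clause ℕ} (hc : c ∈ normCNF n₀ F) {l : Literal ℕ} (hl : l ∈ c) :
    l.1 ≤ n + F.length + n₀ := by
  have hN : F.numVars ≤ n := numVars_le_iff.2 hF
  rcases SoloRes.mem_normCNF_iff.1 hc with ⟨c₀, hc₀, rfl⟩ | ⟨i, hi, rfl⟩
  · unfold SoloRes.normClause at hl
    split_ifs at hl
    · simp only [List.mem_singleton] at hl
      subst hl
      show F.numVars ≤ _
      omega
    · have := hF c₀ hc₀ l hl
      omega
  · simp only [List.mem_singleton] at hl
    subst hl
    show F.numVars + 1 + i ≤ _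
    omega

/-- **`|code N(F)| ≤ 360 r² + 204 r + 2`** for a dense 3-CNF `F`, `r ≥ |F|, n₀`. [folklore] -/
theorem length_cnfE_normCNF_le {F : CNF ℕ} {n₀ r : ℕ} (hw : F.IsWidthLE 3)
    (hd : ∀ c ∈ F, ∀ l ∈ c, l.1 < 3 * F.length) (hF : F.length ≤ r) (hn : n₀ ≤ r) :
    (cnfE (normCNF n₀ F)).length ≤ 360 * r ^ 2 + 204 * r + 2 := by
  have hV : ∀ c ∈ normCNF n₀ F, ∀ l ∈ c, l.1 ≤ 5 * r := fun c hc l hl =>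
    (le_of_mem_normCNF hd hc hl).trans (by omega)
  have h := length_cnfE_le (SoloRes.isWidthLE_normCNF hw n₀) hV
  have hlen : (normCNF n₀ F).length ≤ 3 * r := by rw [length_normCNF]; omega
  calc _ ≤ _ := h
    _ ≤ 2 * (3 * r) + 2 + (3 * r) * (2 * (2 * 3 + 2 + 3 * (2 * (2 * (5 * r) + 3) + 2)) + 2) := by
        gcongr
    _ = 360 * r ^ 2 + 204 * r + 2 := by ring

/-- Every `ℕ`-polynomial is eventually below `2^{r^{1/d}}`. [folklore] -/
theorem exists_eval_lt_two_rpow (Q : Polynomial ℕ) {d : ℝ} (hd : 0 < d) :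
    ∃ R : ℕ, ∀ r : ℕ, R ≤ r → ((Q.eval r : ℕ) : ℝ) < (2 : ℝ) ^ ((r : ℝ) ^ (1 / d)) := by
  obtain ⟨c, k, hck⟩ := exists_eval_le_mul_pow_add Q
  obtain ⟨R₀, hR₀⟩ := SoloRes.exists_pow_le_two_rpow (k + 2) hd
  refine ⟨max R₀ (2 * c + 2), fun r hr => ?_⟩
  obtain ⟨hr0, hrc⟩ := max_le_iff.1 hr
  have hk1 : 1 ≤ r ^ k := Nat.one_le_pow _ _ (by omega)
  have h1 : Q.eval r ≤ r ^ (k + 1) :=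
    calc Q.eval r ≤ c * r ^ k + c := hck r
      _ ≤ c * r ^ k + c * r ^ k := by nlinarith
      _ = (2 * c) * r ^ k := by ring
      _ ≤ r * r ^ k := Nat.mul_le_mul_right _ (by omega)
      _ = r ^ (k + 1) := by ring
  have h2 : r ^ (k + 1) < r ^ (k + 2) := Nat.pow_lt_pow_right (by omega) (by omega)
  calc ((Q.eval r : ℕ) : ℝ) < ((r ^ (k + 2) : ℕ) : ℝ) := by exact_mod_cast h1.trans_lt h2
    _ = (r : ℝ) ^ (k + 2) := by push_cast; ring
    _ ≤ _ := hR₀ r hr0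

/-- **The gap threshold** (`q`-dependent padding): there are `n₁, C` such that for every dense
3-CNF `F`, with `H = G(N F)`, `r = |H|`: `F` satisfiable ⇒ `H` has a refutation with `≤ r^C` lines;
`F` unsatisfiable ⇒ every refutation of `H` is longer than `q(|⟨code H, 1^{r^C}⟩|)`.
[cite: AtseriasMuller2020, Thm 2 (a)+(b) and §6] -/
theorem exists_gap_threshold (q : Polynomial ℕ) :
    ∃ n₁ C : ℕ, ∀ F : CNF ℕ, F.IsWidthLE 3 → (∀ c ∈ F, ∀ l ∈ c, l.1 < 3 * F.length) →
      (F.Satisfiable → ∃ π : List (ResLine ℕ), IsResRefutation (rrefGadget (normCNF n₁ F)) π ∧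
          π.length ≤ (rrefGadget (normCNF n₁ F)).size ^ C) ∧
      (¬ F.Satisfiable → ∀ π : List (ResLine ℕ), IsResRefutation (rrefGadget (normCNF n₁ F)) π →
          q.eval (boolPair (cnfE (rrefGadget (normCNF n₁ F)))
            (unE ((rrefGadget (normCNF n₁ F)).size ^ C))).length < π.length) := by
  obtain ⟨c, d, hc, hd, n₀, hAM⟩ := rrefGadget_hardness_holds
  obtain ⟨p, hp⟩ := rrefGadget_encode_length_le'
  obtain ⟨R, hR⟩ := exists_eval_lt_two_rpow
    (q.comp (2 * p.comp (360 * Polynomial.X ^ 2 + 204 * Polynomial.X + 2) + 2 +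
      Polynomial.X ^ ⌈c⌉₊)) hd
  refine ⟨max n₀ (max R 1), ⌈c⌉₊, fun F hw hdn => ?_⟩
  set C := ⌈c⌉₊
  set n₁ := max n₀ (max R 1)
  set G := rrefGadget (normCNF n₁ F)
  have hcard : F.length + n₁ ≤ (CNF.vars (normCNF n₁ F)).card := SoloRes.le_card_vars_normCNF n₁ F
  have hr : (CNF.vars (normCNF n₁ F)).card ≤ G.size := card_vars_le_size_rrefGadget _
  have hn₀ : n₀ ≤ (CNF.vars (normCNF n₁ F)).card :=
    (le_max_left _ _).trans ((Nat.le_add_left _ _).trans hcard)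
  have h1 : 1 ≤ n₁ := (le_max_right _ _).trans (le_max_right _ _)
  have hn₁r : n₁ ≤ G.size := ((Nat.le_add_left _ _).trans hcard).trans hr
  have hFr : F.length ≤ G.size := ((Nat.le_add_right _ _).trans hcard).trans hr
  have hRr : R ≤ G.size := ((le_max_left _ _).trans (le_max_right _ _)).trans hn₁r
  have hr1 : 1 ≤ G.size := h1.trans hn₁r
  have hAMF := hAM (normCNF n₁ F) (SoloRes.isWidthLE_normCNF hw n₁)
    (SoloRes.isNonTaut_of_mem_normCNF n₁ F) (SoloRes.length_normCNF_le h1 F) hn₀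
  constructor
  · intro hsat
    obtain ⟨π, hπ, hlen⟩ := hAMF.1 (SoloRes.satisfiable_normCNF_of hsat n₁)
    have hle : (G.size : ℝ) ^ c ≤ (G.size : ℝ) ^ (C : ℝ) :=
      Real.rpow_le_rpow_of_exponent_le (by exact_mod_cast hr1) (Nat.le_ceil c)
    rw [Real.rpow_natCast] at hle
    have : (π.length : ℝ) < ((G.size ^ C : ℕ) : ℝ) := by push_cast; exact hlen.trans_le hle
    exact ⟨π, hπ, (Nat.cast_lt.1 this).le⟩
  · intro hunsat π hπ
    have hlow := hAMF.2 (fun h => hunsat (SoloRes.satisfiable_of_normCNF h)) π hπ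
    have hGlen : (cnfE G).length ≤
        p.eval ((360 * Polynomial.X ^ 2 + 204 * Polynomial.X + 2 : Polynomial ℕ).eval G.size) := by
      have h := hp (normCNF n₁ F)
      rw [cnfE_eq] at h
      refine h.trans (TM2Iter.eval_mono p ?_)
      have := length_cnfE_normCNF_le hw hdn hFr hn₁r
      simpa using this
    have hin : (boolPair (cnfE G) (unE (G.size ^ C))).length ≤
        (2 * p.comp (360 * Polynomial.X ^ 2 + 204 * Polynomial.X + 2) + 2 +
          Polynomial.X ^ C : Polynomial ℕ).eval G.size := by
      rw [length_boolPair, length_unE]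
      simp only [Polynomial.eval_add, Polynomial.eval_mul, Polynomial.eval_pow, Polynomial.eval_X,
        Polynomial.eval_comp, Polynomial.eval_ofNat]
      have := hGlen
      simp only [Polynomial.eval_add, Polynomial.eval_mul, Polynomial.eval_pow, Polynomial.eval_X,
        Polynomial.eval_ofNat] at this
      omega
    have hq : q.eval (boolPair (cnfE G) (unE (G.size ^ C))).length ≤
        (q.comp (2 * p.comp (360 * Polynomial.X ^ 2 + 204 * Polynomial.X + 2) + 2 +
          Polynomial.X ^ C)).eval G.size := by
      rw [Polynomial.eval_comp]; exact TM2Iter.eval_mono q hin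
    have : ((q.eval (boolPair (cnfE G) (unE (G.size ^ C))).length : ℕ) : ℝ) < π.length :=
      ((Nat.cast_le.2 hq).trans_lt (hR G.size hRr)).trans hlow
    exact_mod_cast this

/-- `F ↦ ⟨G(N (rankCNF F)), 1^{r^C}⟩` on codes. [cite: AtseriasMuller2020, Thm 2 (G poly-time)] -/
theorem instRankFP (n₁ C : ℕ) :
    CodeFP cnfE (pairE cnfE unE) (fun F => (rrefGadget (normCNF n₁ (rankCNF F)),
      (rrefGadget (normCNF n₁ (rankCNF F))).size ^ C)) :=
  ((SoloRes.instanceFP rrefGadget_polyTime_holds n₁ C).comp rankFP).congr fun _ => rfl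

/-- A string function `g ∈ FP` read on pair codes. [cite: AroraBarakCC2009, §1.3] -/
theorem pairArgFP {g : List Bool → List Bool} (hg : g ∈ FP) :
    CodeFP (pairE cnfE unE) strE (fun p => g (boolPair (cnfE p.1) (unE p.2))) :=
  ⟨g, hg, fun p => by rw [pairE_apply]; rfl⟩

/-- **The checking bit is polynomial-time**: `F ↦ refB(H, |W|, W)`, `H = G(N (rankCNF F))`, `W`
decoded (`SumcheckIP.decCNFC`) from `g ⟨code H, 1^{|H|^C}⟩`. [cite: AtseriasMuller2020, Thm 1] -/
theorem chkFP {g : List Bool → List Bool} (hg : g ∈ FP) (n₁ C : ℕ) :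
    CodeFP cnfE bitE (fun F =>
      SoloResNP.refB (rrefGadget (normCNF n₁ (rankCNF F)))
        (NegCNF.decCNF (g (boolPair (cnfE (rrefGadget (normCNF n₁ (rankCNF F))))
          (unE ((rrefGadget (normCNF n₁ (rankCNF F))).size ^ C))))).length
        (NegCNF.decCNF (g (boolPair (cnfE (rrefGadget (normCNF n₁ (rankCNF F))))
          (unE ((rrefGadget (normCNF n₁ (rankCNF F))).size ^ C)))))) := by
  -- `congr` steps by `simp only []` (projection-of-pair reductions), never by `rfl`: unification
  -- would otherwise unfold the gadget (`Prod.fst (G …, _) =?= G …` by lazy delta).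
  have hW : CodeFP cnfE cnfE (fun F => NegCNF.decCNF (g (boolPair
      (cnfE (rrefGadget (normCNF n₁ (rankCNF F))))
      (unE ((rrefGadget (normCNF n₁ (rankCNF F))).size ^ C))))) :=
    ((SumcheckIP.decCNFC : CodeFP strE cnfE NegCNF.decCNF).comp
      ((pairArgFP hg).comp (instRankFP n₁ C))).congr fun _ => by simp only []
  have hH : CodeFP cnfE cnfE (fun F => rrefGadget (normCNF n₁ (rankCNF F))) :=
    ((fst _ _).comp (instRankFP n₁ C)).congr fun _ => by simp only []
  have hL : CodeFP cnfE unE (fun F => (NegCNF.decCNF (g (boolPair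
      (cnfE (rrefGadget (normCNF n₁ (rankCNF F))))
      (unE ((rrefGadget (normCNF n₁ (rankCNF F))).size ^ C))))).length) :=
    (ulengthFP.comp hW).congr fun _ => rfl
  exact (SoloResNP.refFP.comp (hH.pair (hL.pair hW))).congr fun F => by simp only []

/-- A decoded clause list is no longer than its code. [folklore] -/
private theorem length_decCNF_le (y : List Bool) : (NegCNF.decCNF y).length ≤ y.length := by
  rw [NegCNF.decCNF, NegCNF.length_decList]
  exact (Nat.le_add_right _ _).trans (NegCNF.length_bu_le y)

end SoloResAut

open SoloResAut in
/-- **`3SAT ∈ P` from a pad-automating `g ∈ FP`** [Atserias–Müller 2020, Thm 1]: rename densely,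
pad by `n₁(q)`, apply `G`, run `g` with budget `r^C`, accept iff the output decodes to a refutation
(sound on unsatisfiable `F`: every refutation is longer than `g` can write, `exists_gap_threshold`).
[cite: AtseriasMuller2020, Thm 1 and Thm 2] -/
theorem soloInformed_kSAT_three_mem_P_of_resPadSearchFn {g : List Bool → List Bool} (hg : g ∈ FP)
    (hspec : g ∈ resPadSearchFns) : kSAT 3 ∈ Classes.P := by
  rw [resPadSearchFns, Set.mem_setOf_eq] at hspec
  obtain ⟨q, hq⟩ := exists_poly_length_le_of_mem_FP hg
  obtain ⟨n₁, C, hthr⟩ := exists_gap_threshold q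
  obtain ⟨f, hf, hfF⟩ := chkFP hg n₁ C
  refine mem_P_of_mem_FP
    (iteFn_mem_FP (Brick.andFn_mem_FP KSATRed.isCanonFn_mem_FP (KSATRed.widthLEFn_mem_FP 3)) hf
      (const_mem_FP [false])) (kSAT 3) fun x => ?_
  by_cases hx : encodingCNF.encode (NegCNF.decCNF x) = x
  · rw [← hx]
    have hcan : KSATRed.isCanonFn (encodingCNF.encode (NegCNF.decCNF x)) = [true] := by
      rw [KSATRed.isCanonFn_apply, KSATRed.decCNF_encode]; simp
    rw [iteFn_apply (Brick.andFn_apply hcan (KSATRed.widthLEFn_encode 3 _)), mem_kSAT_iff,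
      Bool.true_and]
    set F := NegCNF.decCNF x
    by_cases hw : CNF.IsWidthLE 3 F
    · rw [decide_eq_true hw, if_pos rfl, cnfE_eq, hfF]
      beta_reduce
      set H := rrefGadget (normCNF n₁ (rankCNF F))
      set W := NegCNF.decCNF (g (boolPair (cnfE H) (unE (H.size ^ C))))
      have hd :=
        hthr (rankCNF F) (isWidthLE_rankCNF hw) (fun c hc l hl => lt_of_mem_rankCNF hw hc hl)
      have hiff : SoloResNP.refB H W.length W = true ↔ F.Satisfiable := by
        rw [SoloResNP.refB_eq_true_iff, ← satisfiable_rankCNF_iff F]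
        constructor
        · rintro ⟨hπ, -⟩
          by_contra hun
          have h1 := hd.2 hun _ hπ
          have h2 : (W.map SoloResNP.lineOf).length ≤
              q.eval (boolPair (cnfE H) (unE (H.size ^ C))).length := by
            rw [List.length_map]; exact (length_decCNF_le _).trans (hq _)
          exact absurd h1 (not_lt.2 h2)
        · intro hsat
          obtain ⟨π, hπ, hlen⟩ := hd.1 hsat
          have := hspec H (H.size ^ C) ⟨π, hπ, hlen⟩
          rw [cnfE_eq] at this
          exact ⟨this, le_rfl⟩
      constructor
      · rintro ⟨-, hsat⟩
        rw [hiff.2 hsat]; rfl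
      · intro hns
        have : SoloResNP.refB H W.length W = false := by
          rw [Bool.eq_false_iff]; exact fun h' => hns ⟨hw, hiff.1 h'⟩
        rw [this]; rfl
    · rw [decide_eq_false hw, if_neg Bool.false_ne_true]
      exact ⟨fun h => (hw h.1).elim, fun _ => rfl⟩
  · have hcan : KSATRed.isCanonFn x = [false] := by rw [KSATRed.isCanonFn_apply]; simp [hx]
    obtain ⟨b, hb⟩ := KSATRed.oneBit_widthLEFn 3 x
    rw [iteFn_apply (Brick.andFn_apply hcan hb), Bool.false_and, if_neg Bool.false_ne_true]
    exact ⟨fun h => (hx (KSATRed.encode_decCNF_of_mem h)).elim, fun _ => rfl⟩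

/-- **A pad-automating `g ∈ FP` gives `NP ⊆ P`** (`3SAT` is NP-hard).
[cite: AtseriasMuller2020, Thm 1] [cite: AroraBarakCC2009, Thm. 2.8] -/
theorem soloInformed_NP_subset_P_of_resPadSearchFn {g : List Bool → List Bool} (hg : g ∈ FP)
    (hspec : g ∈ resPadSearchFns) : Nondeterministic.NP ⊆ Classes.P :=
  NP_subset_P_of_isNPHard_of_mem_P_holds isNPComplete_kSAT_three_holds.isHard
    (soloInformed_kSAT_three_mem_P_of_resPadSearchFn hg hspec)

/-- **The search face of the summit: `PneNP ↔` Resolution is not pad-automatable** — `P ≠ NP` iff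
no polynomial-time function, given a CNF with a refutation of at most `s` lines (`s` in unary),
outputs a Resolution refutation of it. [cite: AtseriasMuller2020, Thm 1] -/
theorem soloInformed_pneNP_iff_forall_not_mem_resPadSearchFns :
    PneNP ↔ ∀ g ∈ FP, g ∉ resPadSearchFns := by
  rw [soloInformed_pneNP_iff_exists_not_mem]
  refine ⟨fun ⟨L, hL, hLP⟩ g hg hs => hLP (soloInformed_NP_subset_P_of_resPadSearchFn hg hs hL),
    fun h => Classical.byContradiction fun hne => ?_⟩
  push Not at hne
  obtain ⟨g, hg, hs⟩ := soloInformed_exists_resPadSearchFn_of_NP_subset_P fun L hL => hne L hL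
  exact h g hg hs

/-- **Search ≡ decision for Resolution proof search**: `RESBOUND ∈ P` iff some `g ∈ FP` is
pad-automating. [cite: AtseriasMuller2020, Thm 1] -/
theorem soloInformed_resBound_mem_P_iff_exists_resPadSearchFn :
    resBoundLang ∈ Classes.P ↔ ∃ g ∈ FP, g ∈ resPadSearchFns := by
  have h1 := soloInformed_pneNP_iff_forall_not_mem_resPadSearchFns
  refine ⟨fun hP => Classical.byContradiction fun hne => ?_, fun ⟨g, hg, hs⟩ =>
    Classical.byContradiction fun hP => h1.1 (soloInformed_pneNP_iff_resBound.2 hP) g hg hs⟩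
  push Not at hne
  exact soloInformed_pneNP_iff_resBound.1 (h1.2 hne) hP

end Summit.PneNP.PneNP.Theorems
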